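import Mathlib
import Summits.Schanuel.Schanuel.Statement
import Literature.NumberTheory.Transcendental.RoyCriterion
import Literature.NumberTheory.Transcendental.RoySmallValueEstimates
import Summits.Schanuel.Schanuel.Theorems.SoloBlindRoyWindow
import HarnessLib

/-!
# Roy's 2013 small value estimate never meets Conjecture-2 data (solo-Schanuel-blind)

Dictionary. Restrict the data of Roy's Conjecture 2 [Roy2001] (parameters in the window
`RoyAdmissible s₀ s₁ t₀ t₁ u`) to the single point `(y₁, α₁)`: a non-zero `P_N ∈ ℤ[X₀,X₁]` of
total degree `D ≍ N^{t₀}` (the window forces `t₁ < t₀`, `royAdmissible_ranges`), height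
`≤ e^N = exp(D^{1/t₀})`, whose `D`-derivatives of order `< N^{s₀} = D^{s₀/t₀}` at the point are
`≤ exp(-N^u) = exp(-D^{u/t₀})`.  In the normalisation of Roy's proven small value estimate on
`G_a × G_m` (Roy 2013, Thm 1.1 = the in-tree named fact
`Literature.NumberTheory.Transcendental.roy2013_thm_1_1`: hypotheses `1 ≤ τ < 2`, `τ < β`,
`2 + β - τ + (τ-1)(2-τ)/(β+1-τ) < ν`; conclusion `ξ, η ∈ ℚ̄`) this is
`(β, τ, ν) = (1/t₀, s₀/t₀, u/t₀)`.

We check in the kernel that this dictionary lands OUTSIDE the hypotheses of Thm 1.1 for every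
admissible quintuple, twice over:

* `roy2013Dictionary_not_tau_lt_beta` : `¬ (s₀/t₀ < 1/t₀)` — the hypothesis `τ < β` reads `s₀ < 1`,
  false in the window (`1 < s₀`);
* `roy2013Dictionary_below_threshold` : `u/t₀ < 2 + 1/t₀ - s₀/t₀`, i.e. `u + s₀ < 1 + 2t₀` — the
  smallness exponent stays strictly below the MAIN term `2 + β - τ` of the threshold (which is the
  Dirichlet exponent of the single-point problem: for `ν < 2 + β - τ` such polynomials exist at
  every point, [Roy2013, §1, after Thm 1.1]); the correction term `(τ-1)(2-τ)/(β+1-τ)` is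
  non-negative whenever `1 ≤ τ ≤ 2` since `β + 1 - τ > 0` here (`roy2013Dictionary_corr_denom_pos`:
  `s₀ < 1 + t₀`), so the full threshold fails as well (`roy2013Dictionary_not_threshold`).

Reading (wall.md §3 (A)): the only proven small value estimate on the coupled group `G_a × G_m`
starts just above the Dirichlet exponent of ITS interpolation problem and concludes degeneracy;
Conjecture-2 data sit strictly below it (margin `t₀ - t₁ > 0` in `u + s₀`), in the regime where
data exist at every point of the graph of `exp`.

[cite: Roy2001, Conjecture 2 and condition (1); Roy 2013 (Mathematika 59), Theorem 1.1,
arXiv:1301.0663 p. 3]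
-/

namespace Summit.Schanuel.Schanuel.Theorems

open Literature.NumberTheory.Transcendental

variable {s₀ s₁ t₀ t₁ u : ℝ}

/-- `τ < β` fails for the dictionary `(β, τ) = (1/t₀, s₀/t₀)`: it would say `s₀ < 1`. -/
theorem roy2013Dictionary_not_tau_lt_beta (h : RoyAdmissible s₀ s₁ t₀ t₁ u) :
    ¬ (s₀ / t₀ < 1 / t₀) := by
  obtain ⟨h0, h1, h2, h3, h4, g1, -⟩ := royAdmissible_unpack h
  intro hlt
  have := (div_lt_div_iff_of_pos_right h2).mp hlt
  linarith

/-- The window keeps `u + s₀ < 1 + t₀ + t₁ < 1 + 2 t₀`. -/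
theorem roy2013Dictionary_sum_lt (h : RoyAdmissible s₀ s₁ t₀ t₁ u) :
    u + s₀ < 1 + t₀ + t₁ ∧ u + s₀ < 1 + 2 * t₀ := by
  obtain ⟨h0, h1, h2, h3, h4, g1, g2, g3, g4, g5, g6, k1, k2, k3⟩ := royAdmissible_unpack h
  obtain ⟨-, -, -, -, -, r6, -⟩ := royAdmissible_ranges h
  constructor <;> linarith

/-- The smallness exponent `ν = u/t₀` stays below the main term `2 + β - τ` of Roy's threshold. -/
theorem roy2013Dictionary_below_threshold (h : RoyAdmissible s₀ s₁ t₀ t₁ u) :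
    u / t₀ < 2 + 1 / t₀ - s₀ / t₀ := by
  obtain ⟨h0, h1, h2, h3, h4, g1, -⟩ := royAdmissible_unpack h
  have hs := (roy2013Dictionary_sum_lt h).2
  have : 2 + 1 / t₀ - s₀ / t₀ = (2 * t₀ + 1 - s₀) / t₀ := by
    field_simp
  rw [this, div_lt_div_iff_of_pos_right h2]
  linarith

/-- The denominator of the correction term is positive: `β + 1 - τ = (1 + t₀ - s₀)/t₀ > 0`. -/
theorem roy2013Dictionary_corr_denom_pos (h : RoyAdmissible s₀ s₁ t₀ t₁ u) :
    0 < 1 / t₀ + 1 - s₀ / t₀ := by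
  obtain ⟨h0, h1, h2, h3, h4, g1, g2, g3, g4, g5, g6, k1, k2, k3⟩ := royAdmissible_unpack h
  obtain ⟨-, -, -, -, r5, -⟩ := royAdmissible_ranges h
  have : 1 / t₀ + 1 - s₀ / t₀ = (1 + t₀ - s₀) / t₀ := by
    field_simp
  rw [this]
  exact div_pos (by linarith) h2

/-- Hence the full threshold hypothesis of `roy2013_thm_1_1` fails for the dictionary whenever the
remaining hypothesis `1 ≤ τ ≤ 2` (here `t₀ ≤ s₀ ≤ 2t₀`) holds: the correction term is then
non-negative. -/
theorem roy2013Dictionary_not_threshold (h : RoyAdmissible s₀ s₁ t₀ t₁ u)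
    (hτ : s₀ / t₀ ≤ 2) :
    ¬ (2 + 1 / t₀ - s₀ / t₀ + (s₀ / t₀ - 1) * (2 - s₀ / t₀) / (1 / t₀ + 1 - s₀ / t₀) < u / t₀) := by
  obtain ⟨h0, h1, h2, h3, h4, g1, g2, -⟩ := royAdmissible_unpack h
  have hmain := roy2013Dictionary_below_threshold h
  have hden := roy2013Dictionary_corr_denom_pos h
  have hτ1 : 1 ≤ s₀ / t₀ := by
    rw [le_div_iff₀ h2]; linarith
  have hcorr : 0 ≤ (s₀ / t₀ - 1) * (2 - s₀ / t₀) / (1 / t₀ + 1 - s₀ / t₀) :=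
    div_nonneg (mul_nonneg (by linarith) (by linarith)) hden.le
  intro hlt
  linarith

#harness_tags roy2013Dictionary_not_threshold

end Summit.Schanuel.Schanuel.Theorems
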